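import Summits.KontsevichZagierPeriods.KontsevichZagierPeriods.Theses.SymplecticScissors
import Literature.NumberTheory.Transcendental.KZGroundingRelations
import Literature.NumberTheory.Transcendental.SemialgebraicMapsProofs
import Literature.NumberTheory.Transcendental.SemialgebraicMapsSmoothProofs
import Literature.NumberTheory.Transcendental.SemialgebraicVolume

/-!
# Crux `SymplecticScissors.PlanarAreas` (stmt-KontsevichZagierPeriods-4990), line
`green-native-bands`, stub `stub_derivIntegrable`: integrability of the Green bulk `∂_b A`

The common bulk of the Green chain on the closed standard triangle `Δ = {0 ≤ a, 0 ≤ b, a + b ≤ 1}`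
is `[Δ, h]`, `h = ∂_b A` extended by `0` off the open triangle `Δ°`
(`h p = if p ∈ Δ° then deriv (b ↦ A (p₀, b)) (p₁) else 0`), for `A` CONTINUOUS and `ℚ`-semialgebraic
on `Δ`; a representation must be absolutely integrable [Kontsevich–Zagier 2001, §1.1–1.2]. This file
proves it (`stub_derivIntegrable`, registered signature; the `ℚ`-semialgebraicity of `h` on `Δ` is a
hypothesis, supplied by the neighbouring stub `stub_fibreDerivSemialgebraic`). `h` may blow up
(`A = sign (b − a) |b − a|^{1/2}`), but `∫_Δ |h| < ∞`:

1. `|A| ≤ M` on the compact `Δ`; off a `ℚ`-semialgebraic null `Z` the function `A` is `C^∞` on `Δ°`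
   (`IsSemialgebraicFunOn.exists_contDiffOn_holds`, `volume_frontier_eq_zero_of_isSemialgebraic`),
   so there `b ↦ A(a, b)` has derivative `h` (`hasDerivAt_fibre`), and `h` is measurable.
2. The sign sets `σ± = {±h > 0} ∩ (Δ° \ Z)` are `ℚ`-semialgebraic
   (`IsSemialgebraicFunOn.isSemialgebraic_sep_lt`) and `|h| ≤ 1_{σ₊}|h| + 1_{σ₋}|h|` off `Z`.
3. `∫ 1_{σ±} |h| < ∞` (`lintegral_indicator_enorm_lt_top`, applied to `±A`): a cylindrical
   decomposition of `ℝ²` adapted to `σ±` (Basu–Pollack–Roy 2006, Cor. 5.7,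
   `IsSemialgebraic.exists_cylindricalDecomposition.exists_fibre_eq`) cuts every vertical fibre into
   null section values and at most `L + 1` band intervals, on each of which `b ↦ ±A(a, b)` is a
   continuous monotone primitive, so the fibre integral of `|h|` is `≤ (L + 1) · 2M`
   (`intervalIntegral.integrableOn_deriv_of_nonneg` + FTC: `lintegral_Ioo_enorm_le_of_hasDerivAt`,
   `lintegral_bandFibre_le`, `lintegral_fibre_le`; an extreme band cannot lie in a bounded fibre,
   `KZ.volume_bandFibre_eq_top`), and Tonelli along the last coordinate
   (`lintegral_eq_lintegral_lintegral_snoc`) over `a ∈ (0, 1)` concludes.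

Sources: M. Kontsevich, D. Zagier, *Periods* (2001), §1.2; S. Basu, R. Pollack, M.-F. Roy,
*Algorithms in Real Algebraic Geometry* (2006), Cor. 5.7; J. Bochnak, M. Coste, M.-F. Roy, *Real
Algebraic Geometry* (1998), §2.9. No definition, no named fact.
-/

noncomputable section

open scoped ENNReal
open Set MeasureTheory
open Literature.NumberTheory.Transcendental
open Literature.ModelTheory.ExponentialFields (IsSemialgebraic bandLower bandUpper)

namespace Summit.KontsevichZagierPeriods.SymplecticScissors.PlanarAreas

/-! ## Fibrewise fundamental theorem of calculus, bands and fibres -/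

/-- **Fibrewise FTC for a monotone primitive.** If `g` is continuous on `[a, b]` (`a < b`) with
derivative `g' t ≥ 0` at every `t ∈ (a, b)`, then `g'` is integrable on `(a, b)`
(`intervalIntegral.integrableOn_deriv_of_nonneg`) and `∫⁻_{(a,b)} ‖g'‖ = ∫_a^b g' = g b − g a`
(`intervalIntegral.integral_eq_sub_of_hasDerivAt_of_le`); we record the inequality. [folklore] -/
theorem lintegral_Ioo_enorm_le_of_hasDerivAt {g g' : ℝ → ℝ} {a b : ℝ} (hab : a < b)
    (hcont : ContinuousOn g (Icc a b)) (hder : ∀ t ∈ Ioo a b, HasDerivAt g (g' t) t)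
    (hpos : ∀ t ∈ Ioo a b, 0 ≤ g' t) :
    ∫⁻ t in Ioo a b, ‖g' t‖ₑ ≤ ENNReal.ofReal (g b - g a) := by
  have hint : IntegrableOn g' (Ioc a b) :=
    intervalIntegral.integrableOn_deriv_of_nonneg hcont hder hpos
  rw [setLIntegral_congr_fun measurableSet_Ioo fun t ht => Real.enorm_of_nonneg (hpos t ht),
    ← ofReal_integral_eq_lintegral_ofReal (hint.mono_set Ioo_subset_Ioc_self)
      (ae_restrict_of_forall_mem measurableSet_Ioo hpos),
    ← integral_Ioc_eq_integral_Ioo, ← intervalIntegral.integral_of_le hab.le,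
    intervalIntegral.integral_eq_sub_of_hasDerivAt_of_le hab.le hcont hder
      ((intervalIntegrable_iff_integrableOn_Ioc_of_le hab.le).2 hint)]

/-- **One band of a bounded fibre.** Let `g` be continuous on `[u, v]` with `|g| ≤ M` there, and let
the `j`-th band fibre `I = {t | ξ_{j-1} x < t < ξ_j x}` (conventions `ξ_{-1} = -∞`, `ξ_ℓ = +∞`) lie
in `(u, v)`, `g` having derivative `g' ≥ 0` on `I`. Then `∫⁻_I ‖g'‖ ≤ 2M`: an extreme band has
infinite length (`KZ.volume_bandFibre_eq_top`), so `j` is inner and `I` is an open interval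
(`KZ.bandFibre_eq_Ioo`), empty or `(a', b')` with `u ≤ a' < b' ≤ v`, where the fibrewise FTC gives
`∫⁻ ‖g'‖ ≤ g b' − g a' ≤ 2M`. [folklore] -/
theorem lintegral_bandFibre_le {g g' : ℝ → ℝ} {u v M : ℝ} (hcont : ContinuousOn g (Icc u v))
    (hM : ∀ s ∈ Icc u v, |g s| ≤ M) {n l : ℕ} (ξ : Fin l → (Fin n → ℝ) → ℝ) (j : Fin (l + 1))
    (x : Fin n → ℝ)
    (hI : {t : ℝ | bandLower ξ j x < t ∧ (t : EReal) < bandUpper ξ j x} ⊆ Ioo u v)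
    (hder : ∀ t ∈ {t : ℝ | bandLower ξ j x < t ∧ (t : EReal) < bandUpper ξ j x},
      HasDerivAt g (g' t) t)
    (hpos : ∀ t ∈ {t : ℝ | bandLower ξ j x < t ∧ (t : EReal) < bandUpper ξ j x}, 0 ≤ g' t) :
    ∫⁻ t in {t : ℝ | bandLower ξ j x < t ∧ (t : EReal) < bandUpper ξ j x}, ‖g' t‖ₑ ≤
      ENNReal.ofReal (2 * M) := by
  by_cases hj : j = 0 ∨ j = Fin.last l
  · have hle : volume {t : ℝ | bandLower ξ j x < t ∧ (t : EReal) < bandUpper ξ j x} ≤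
        volume (Ioo u v) := measure_mono hI
    rw [KZ.volume_bandFibre_eq_top ξ hj x, Real.volume_Ioo, top_le_iff] at hle
    exact absurd hle ENNReal.ofReal_ne_top
  obtain ⟨hj0, hjl⟩ := not_or.mp hj
  rw [KZ.bandFibre_eq_Ioo ξ hj0 hjl x] at hI hder hpos ⊢
  set a := (bandLower ξ j x).toReal
  set b := (bandUpper ξ j x).toReal
  by_cases hab : a < b
  · obtain ⟨hua, hbv⟩ := (Ioo_subset_Ioo_iff hab).1 hI
    refine (lintegral_Ioo_enorm_le_of_hasDerivAt hab (hcont.mono (Icc_subset_Icc hua hbv))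
      hder hpos).trans (ENNReal.ofReal_le_ofReal ?_)
    have h1 := hM a ⟨hua, hab.le.trans hbv⟩
    have h2 := hM b ⟨hua.trans hab.le, hbv⟩
    rw [abs_le] at h1 h2
    linarith [h1.1, h2.2]
  · rw [Ioo_eq_empty hab, Measure.restrict_empty, lintegral_zero_measure]
    exact bot_le

/-- **The whole bounded fibre.** With `g, g', M, u, v` as in `lintegral_bandFibre_le`, if a set
`T ⊆ (u, v)` on which `g` has derivative `g' ≥ 0` is the union of the section values `ξ_j x`
(`j ∈ G`, a null set) and of the band fibres indexed by `B ⊆ Fin (ℓ + 1)` — the shape of a vertical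
fibre of a set adapted to a cylindrical decomposition — then `∫⁻_T ‖g'‖ ≤ (ℓ + 1) · 2M`.
[folklore] -/
theorem lintegral_fibre_le {g g' : ℝ → ℝ} {u v M : ℝ} (hcont : ContinuousOn g (Icc u v))
    (hM : ∀ s ∈ Icc u v, |g s| ≤ M) {T : Set ℝ} (hT : T ⊆ Ioo u v)
    (hder : ∀ t ∈ T, HasDerivAt g (g' t) t) (hpos : ∀ t ∈ T, 0 ≤ g' t) {n l : ℕ}
    (ξ : Fin l → (Fin n → ℝ) → ℝ) (x : Fin n → ℝ) (G : Finset (Fin l)) (B : Finset (Fin (l + 1)))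
    (hfib : T = (⋃ j ∈ G, {ξ j x}) ∪
      ⋃ j ∈ B, {t : ℝ | bandLower ξ j x < t ∧ (t : EReal) < bandUpper ξ j x}) :
    ∫⁻ t in T, ‖g' t‖ₑ ≤ ((l : ℝ≥0∞) + 1) * ENNReal.ofReal (2 * M) := by
  classical
  set I : Fin (l + 1) → Set ℝ := fun j =>
    {t : ℝ | bandLower ξ j x < t ∧ (t : EReal) < bandUpper ξ j x} with hI
  have hG0 : volume (⋃ j ∈ G, ({ξ j x} : Set ℝ)) = 0 :=
    (measure_biUnion_null_iff G.countable_toSet).2 fun j _ => measure_singleton _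
  have hIT : ∀ j ∈ B, I j ⊆ T := fun j hj t ht => by
    rw [hfib]
    exact Or.inr (mem_biUnion hj ht)
  -- subadditivity of `∫⁻` over a finite union
  have hsub : ∀ s : Finset (Fin (l + 1)),
      ∫⁻ t in ⋃ j ∈ s, I j, ‖g' t‖ₑ ≤ ∑ j ∈ s, ∫⁻ t in I j, ‖g' t‖ₑ := by
    intro s
    induction s using Finset.induction_on with
    | empty => simp
    | insert i s hi ih =>
      rw [Finset.set_biUnion_insert, Finset.sum_insert hi]
      exact (lintegral_union_le _ _ _).trans (add_le_add le_rfl ih)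
  calc ∫⁻ t in T, ‖g' t‖ₑ
      ≤ (∫⁻ t in ⋃ j ∈ G, ({ξ j x} : Set ℝ), ‖g' t‖ₑ) + ∫⁻ t in ⋃ j ∈ B, I j, ‖g' t‖ₑ := by
        rw [hfib]; exact lintegral_union_le _ _ _
    _ ≤ 0 + ∑ j ∈ B, ENNReal.ofReal (2 * M) := by
        refine add_le_add (le_of_eq (setLIntegral_measure_zero _ _ hG0)) ((hsub B).trans ?_)
        exact Finset.sum_le_sum fun j hj => lintegral_bandFibre_le hcont hM ξ j x
          ((hIT j hj).trans hT) (fun t ht => hder t (hIT j hj ht)) fun t ht => hpos t (hIT j hj ht)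
    _ = (B.card : ℝ≥0∞) * ENNReal.ofReal (2 * M) := by
        rw [zero_add, Finset.sum_const, nsmul_eq_mul]
    _ ≤ ((l : ℝ≥0∞) + 1) * ENNReal.ofReal (2 * M) := by
        gcongr
        exact_mod_cast (Finset.card_le_univ B).trans_eq (Fintype.card_fin _)

/-! ## Tonelli along the last coordinate; finiteness of `∫ 1_σ |f|` over a sign set `σ` -/

/-- **Cavalieri / Tonelli along the last coordinate** for a measurable `ℝ≥0∞`-valued function on
`ℝ^{m+1}`: `∫⁻ F = ∫⁻_{x ∈ ℝ^m} ∫⁻_{t ∈ ℝ} F (x, t)`, through the volume-preserving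
`MeasurableEquiv.piFinSuccAbove _ (Fin.last m)` (inverse `(t, x) ↦ Fin.snoc x t`) and
`MeasureTheory.lintegral_prod_symm`. [folklore] -/
theorem lintegral_eq_lintegral_lintegral_snoc {m : ℕ} (F : (Fin (m + 1) → ℝ) → ℝ≥0∞)
    (hF : Measurable F) :
    ∫⁻ p, F p = ∫⁻ x : Fin m → ℝ, ∫⁻ t : ℝ, F (Fin.snoc x t) := by
  set e : (Fin (m + 1) → ℝ) ≃ᵐ ℝ × (Fin m → ℝ) :=
    MeasurableEquiv.piFinSuccAbove (fun _ => ℝ) (Fin.last m) with he_def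
  have he : MeasurePreserving e volume (volume.prod volume) :=
    volume_preserving_piFinSuccAbove (fun _ => ℝ) (Fin.last m)
  have hsymm : ∀ p : ℝ × (Fin m → ℝ), e.symm p = Fin.snoc p.2 p.1 := fun p => by
    rw [he_def, MeasurableEquiv.piFinSuccAbove_symm_apply, Fin.insertNthEquiv_last]
    rfl
  calc ∫⁻ p, F p = ∫⁻ q, F (e.symm q) ∂(volume.prod volume) :=
        ((he.symm e).lintegral_comp_emb e.symm.measurableEmbedding F).symm
    _ = ∫⁻ x : Fin m → ℝ, ∫⁻ t : ℝ, F (e.symm (t, x)) :=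
        lintegral_prod_symm _ (hF.comp e.symm.measurable).aemeasurable
    _ = ∫⁻ x : Fin m → ℝ, ∫⁻ t : ℝ, F (Fin.snoc x t) := by simp_rw [hsymm]

/-- **Finiteness over a sign set.** Let `σ` be a `ℚ`-semialgebraic subset of the open standard
triangle; let `F : ℝ² → ℝ` have continuous fibres `s ↦ F (a, s)` on `[0, 1 − a]` bounded by `M`
(`0 < a < 1`), with derivative `f p ≥ 0` at `p₁` for every `p ∈ σ`, `f` measurable. Then
`∫⁻ 1_σ ‖f‖ < ∞`: by Tonelli it suffices to bound the fibre integrals uniformly; over the cells of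
a cylindrical decomposition of `ℝ²` adapted to `σ` (Basu–Pollack–Roy Cor. 5.7,
`IsSemialgebraic.exists_cylindricalDecomposition.exists_fibre_eq`) the fibre `{t | (x, t) ∈ σ}`
(`⊆ (0, 1 − x₀)`) is finitely many section values plus at most `L + 1` band fibres
(`L = max_S ℓ_S`), so `lintegral_fibre_le` bounds its integral by `(L + 1) · 2M` when
`x₀ ∈ (0, 1)`, and it vanishes otherwise. [cite: BasuPollackRoy2006, Cor. 5.7] -/
theorem lintegral_indicator_enorm_lt_top {σ : Set (Fin 2 → ℝ)} {F f : (Fin 2 → ℝ) → ℝ} {M : ℝ}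
    (hσ : IsSemialgebraic ℚ σ) (hσU : ∀ p ∈ σ, 0 < p 0 ∧ 0 < p 1 ∧ p 0 + p 1 < 1)
    (hcont : ∀ a ∈ Ioo (0 : ℝ) 1, ContinuousOn (fun s : ℝ => F ![a, s]) (Icc 0 (1 - a)))
    (hM : ∀ a ∈ Ioo (0 : ℝ) 1, ∀ s ∈ Icc (0 : ℝ) (1 - a), |F ![a, s]| ≤ M)
    (hder : ∀ p ∈ σ, HasDerivAt (fun s : ℝ => F ![p 0, s]) (f p) (p 1))
    (hpos : ∀ p ∈ σ, 0 ≤ f p) (hf : Measurable f) :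
    ∫⁻ p, σ.indicator (fun p => ‖f p‖ₑ) p < ∞ := by
  classical
  have hσm : MeasurableSet σ :=
    Literature.ModelTheory.ExponentialFields.IsSemialgebraic.measurableSet_holds hσ
  obtain ⟨𝒮, l, ξ, hcd, -, -, -, -, hfib⟩ :=
    IsSemialgebraic.exists_cylindricalDecomposition.exists_fibre_eq
      (IsSemialgebraic.exists_cylindricalDecomposition_holds (k := ℚ)) hσ
  have hsnoc : ∀ (x : Fin 1 → ℝ) (t : ℝ), (Fin.snoc x t : Fin 2 → ℝ) = ![x 0, t] := fun x t => by
    ext i; fin_cases i <;> rfl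
  set C : ℝ≥0∞ := ((𝒮.sup l : ℕ) + 1 : ℝ≥0∞) * ENNReal.ofReal (2 * M) with hC
  set D : Set (Fin 1 → ℝ) := {x | x 0 ∈ Ioo (0 : ℝ) 1} with hD
  have hDm : MeasurableSet D := measurableSet_Ioo.preimage (measurable_pi_apply 0)
  rw [lintegral_eq_lintegral_lintegral_snoc _ (hf.enorm.indicator hσm)]
  -- uniform bound of the fibre integrals
  have hbound : ∀ x : Fin 1 → ℝ,
      ∫⁻ t : ℝ, σ.indicator (fun p => ‖f p‖ₑ) (Fin.snoc x t) ≤ D.indicator (fun _ => C) x := by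
    intro x
    -- the fibre of `σ` over `x` lies in `(0, 1 - x 0)`, and is empty unless `x 0 ∈ (0, 1)`
    have hfibre : ∀ t : ℝ, (Fin.snoc x t : Fin 2 → ℝ) ∈ σ →
        x 0 ∈ Ioo (0 : ℝ) 1 ∧ t ∈ Ioo 0 (1 - x 0) := fun t ht => by
      have h := hσU _ ht
      simp only [hsnoc, Matrix.cons_val_zero, Matrix.cons_val_one] at h
      exact ⟨⟨h.1, by linarith [h.2.1, h.2.2]⟩, h.2.1, by linarith [h.2.2]⟩
    by_cases hx : x ∈ D
    · rw [indicator_of_mem hx]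
      have hx' : x 0 ∈ Ioo (0 : ℝ) 1 := hx
      obtain ⟨S, ⟨hS, hxS⟩, -⟩ := hcd.isPartition.2 x
      obtain ⟨G, B, -, -, hfibS⟩ := hfib S hS
      set T : Set ℝ := {t : ℝ | (Fin.snoc x t : Fin 2 → ℝ) ∈ σ} with hT_def
      have hind : ∀ t, σ.indicator (fun p => ‖f p‖ₑ) (Fin.snoc x t) =
          T.indicator (fun t => ‖f (Fin.snoc x t)‖ₑ) t := fun t => by
        by_cases ht : (Fin.snoc x t : Fin 2 → ℝ) ∈ σ
        · rw [indicator_of_mem ht, indicator_of_mem (show t ∈ T from ht)]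
        · rw [indicator_of_notMem ht, indicator_of_notMem (show t ∉ T from ht)]
      simp_rw [hind]
      have hderT : ∀ t ∈ T, HasDerivAt (fun s : ℝ => F ![x 0, s]) (f (Fin.snoc x t)) t := by
        intro t ht
        simpa only [hsnoc, Matrix.cons_val_zero, Matrix.cons_val_one] using hder _ ht
      refine (lintegral_indicator_le _ _).trans ((lintegral_fibre_le (hcont _ hx') (hM _ hx')
        (fun t ht => (hfibre t ht).2) hderT (fun t ht => hpos _ ht) (ξ S) x G B
        (hfibS x hxS)).trans ?_)
      rw [hC]
      gcongr
      exact_mod_cast Finset.le_sup (f := l) hS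
    · rw [indicator_of_notMem hx]
      have h0 : ∀ t, σ.indicator (fun p => ‖f p‖ₑ) (Fin.snoc x t) = 0 := fun t =>
        indicator_of_notMem (fun ht => hx (hfibre t ht).1) _
      simp_rw [h0, lintegral_zero]
      exact le_rfl
  -- integrate the bound over the base
  refine lt_of_le_of_lt (lintegral_mono hbound) ?_
  rw [lintegral_indicator_const hDm]
  have hDfin : volume D < ∞ := by
    refine lt_of_le_of_lt (measure_mono ?_) (measure_Icc_lt_top (a := (0 : Fin 1 → ℝ)) (b := 1))
    exact fun x hx => ⟨fun i => by rw [Subsingleton.elim i 0]; exact le_of_lt hx.1,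
      fun i => by rw [Subsingleton.elim i 0]; exact le_of_lt hx.2⟩
  exact ENNReal.mul_lt_top (ENNReal.mul_lt_top (by simp) ENNReal.ofReal_lt_top) hDfin

/-! ## The triangle, the chain rule along a vertical fibre, and the stub -/

/-- The closed standard triangle is compact (closed, inside the unit square). [folklore] -/
theorem isCompact_triangle : IsCompact {p : Fin 2 → ℝ | 0 ≤ p 0 ∧ 0 ≤ p 1 ∧ p 0 + p 1 ≤ 1} := by
  refine Metric.isCompact_of_isClosed_isBounded
    ((isClosed_le continuous_const (continuous_apply 0)).and <|
      (isClosed_le continuous_const (continuous_apply 1)).and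
        (isClosed_le ((continuous_apply 0).add (continuous_apply 1)) continuous_const))
    ((Metric.isBounded_Icc (0 : Fin 2 → ℝ) 1).subset fun p hp => ?_)
  rw [mem_Icc, Pi.le_def, Pi.le_def, Fin.forall_fin_two, Fin.forall_fin_two]
  simp only [Pi.zero_apply, Pi.one_apply]
  exact ⟨⟨hp.1, hp.2.1⟩, by linarith [hp.2.1, hp.2.2], by linarith [hp.1, hp.2.2]⟩

/-- **Chain rule along a vertical fibre.** If `A : ℝ² → ℝ` is differentiable at `p`, the fibre
function `s ↦ A (p₀, s)` is differentiable at `p₁` (composition with the affine line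
`s ↦ (p₀, s)`), so it has derivative Mathlib's `deriv` there. [folklore] -/
theorem hasDerivAt_fibre {A : (Fin 2 → ℝ) → ℝ} {p : Fin 2 → ℝ} (hA : DifferentiableAt ℝ A p) :
    HasDerivAt (fun s : ℝ => A ![p 0, s]) (deriv (fun s : ℝ => A ![p 0, s]) (p 1)) (p 1) := by
  have hφ : Differentiable ℝ (fun s : ℝ => (![p 0, s] : Fin 2 → ℝ)) :=
    differentiable_pi.2 fun i => by fin_cases i <;> simp
  have hp : (![p 0, p 1] : Fin 2 → ℝ) = p := by ext i; fin_cases i <;> rfl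
  have hA' : DifferentiableAt ℝ A ((fun s : ℝ => (![p 0, s] : Fin 2 → ℝ)) (p 1)) := by
    show DifferentiableAt ℝ A ![p 0, p 1]
    rw [hp]
    exact hA
  exact (hA'.comp (p 1) (hφ (p 1))).hasDerivAt

/-- **Integrability of the bulk** `∂_b A` (extended by `0`) on the closed standard triangle, for
`A` continuous and `ℚ`-semialgebraic there and `∂_b A` `ℚ`-semialgebraic (hypothesis): off the null
non-smooth locus of `A` split the open triangle into the `ℚ`-semialgebraic sign sets of `∂_b A`;
over every vertical fibre each is a union of boundedly many intervals (cylindrical decomposition)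
on which `b ↦ ±A(a, b)` is a continuous monotone primitive, so the fibre integral of `|∂_b A|` is at
most `2 N ‖A‖_∞` (`intervalIntegral.integrableOn_deriv_of_nonneg`, FTC), and Tonelli over
`a ∈ (0, 1)` bounds `∫ |∂_b A|` (`lintegral_indicator_enorm_lt_top`).
[cite: KontsevichZagier2001, §1.2] -/
theorem stub_derivIntegrable : ∀ A : (Fin 2 → ℝ) → ℝ,
    IsSemialgebraicFunOn ℚ {p : Fin 2 → ℝ | 0 ≤ p 0 ∧ 0 ≤ p 1 ∧ p 0 + p 1 ≤ 1} A →
    ContinuousOn A {p : Fin 2 → ℝ | 0 ≤ p 0 ∧ 0 ≤ p 1 ∧ p 0 + p 1 ≤ 1} →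
    IsSemialgebraicFunOn ℚ {p : Fin 2 → ℝ | 0 ≤ p 0 ∧ 0 ≤ p 1 ∧ p 0 + p 1 ≤ 1}
      (fun p => if 0 < p 0 ∧ 0 < p 1 ∧ p 0 + p 1 < 1
        then deriv (fun s : ℝ => A ![p 0, s]) (p 1) else 0) →
    IntegrableOn (fun p => if 0 < p 0 ∧ 0 < p 1 ∧ p 0 + p 1 < 1
        then deriv (fun s : ℝ => A ![p 0, s]) (p 1) else 0)
      {p : Fin 2 → ℝ | 0 ≤ p 0 ∧ 0 ≤ p 1 ∧ p 0 + p 1 ≤ 1} volume := by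
  intro A hA hAc hh
  set Δ : Set (Fin 2 → ℝ) := {p | 0 ≤ p 0 ∧ 0 ≤ p 1 ∧ p 0 + p 1 ≤ 1} with hΔ_def
  set h : (Fin 2 → ℝ) → ℝ := fun p => if 0 < p 0 ∧ 0 < p 1 ∧ p 0 + p 1 < 1
        then deriv (fun s : ℝ => A ![p 0, s]) (p 1) else 0 with hh_def
  have hTS : Literature.ModelTheory.ExponentialFields.tarski_seidenberg_real (k := ℚ) :=
    Literature.ModelTheory.ExponentialFields.tarski_seidenberg_real_holds
  -- the closed and the open triangle
  have hΔsa : IsSemialgebraic ℚ Δ := IsSemialgebraicFunOn.isSemialgebraic_holds hA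
  have hΔm : MeasurableSet Δ :=
    Literature.ModelTheory.ExponentialFields.IsSemialgebraic.measurableSet_holds hΔsa
  set U : Set (Fin 2 → ℝ) := {p | 0 < p 0 ∧ 0 < p 1 ∧ p 0 + p 1 < 1} with hU_def
  have hUsa : IsSemialgebraic ℚ U := by
    have h1 := Literature.ModelTheory.ExponentialFields.isSemialgebraic_setOf_eval_pos (k := ℚ)
      (R := ℝ) (MvPolynomial.X (0 : Fin 2) : MvPolynomial (Fin 2) ℚ)
    have h2 := Literature.ModelTheory.ExponentialFields.isSemialgebraic_setOf_eval_pos (k := ℚ)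
      (R := ℝ) (MvPolynomial.X (1 : Fin 2) : MvPolynomial (Fin 2) ℚ)
    have h3 := Literature.ModelTheory.ExponentialFields.isSemialgebraic_setOf_eval_pos (k := ℚ)
      (R := ℝ) (1 - (MvPolynomial.X (0 : Fin 2) + MvPolynomial.X (1 : Fin 2)) :
        MvPolynomial (Fin 2) ℚ)
    convert (h1.inter h2).inter h3 using 1
    ext p
    simp only [hU_def, mem_setOf_eq, mem_inter_iff, MvPolynomial.aeval_X, map_sub, map_one,
      map_add, sub_pos, and_assoc]
  have hUopen : IsOpen U :=
    (isOpen_lt continuous_const (continuous_apply 0)).and <|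
      (isOpen_lt continuous_const (continuous_apply 1)).and
        (isOpen_lt ((continuous_apply 0).add (continuous_apply 1)) continuous_const)
  have hUΔ : U ⊆ Δ := fun p hp => ⟨hp.1.le, hp.2.1.le, hp.2.2.le⟩
  have hhU : ∀ p, p ∉ U → h p = 0 := fun p hp => if_neg hp
  -- a bound for `A`, and the (null) non-smooth locus of `A` in the open triangle
  obtain ⟨M, hM⟩ := isCompact_triangle.exists_bound_of_continuousOn hAc
  obtain ⟨Z, -, hZsa, hZint, hVopen, hAV⟩ :=
    IsSemialgebraicFunOn.exists_contDiffOn_holds (k := ℚ) hUopen (hA.mono hUΔ hUsa)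
  have hZnull : volume Z = 0 := by
    refine measure_mono_null (fun z hz => ?_) (volume_frontier_eq_zero_of_isSemialgebraic hZsa)
    rw [frontier, hZint, sdiff_empty]
    exact subset_closure hz
  have hVsa : IsSemialgebraic ℚ (U \ Z) := hUsa.diff hZsa
  have hderV : ∀ p ∈ U \ Z, HasDerivAt (fun s : ℝ => A ![p 0, s]) (h p) (p 1) := by
    intro p hp
    rw [show h p = deriv (fun s : ℝ => A ![p 0, s]) (p 1) from if_pos hp.1]
    exact hasDerivAt_fibre ((hAV.differentiableOn (by simp)).differentiableAt (hVopen.mem_nhds hp))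
  -- measurability of `h` (semialgebraic on `Δ`, zero outside)
  have hmeas : Measurable h := by
    have hind : Δ.indicator h = h := by
      refine Set.indicator_eq_self.2 fun p hp => ?_
      by_contra hpΔ
      exact hp (hhU p fun hpU => hpΔ (hUΔ hpU))
    rw [← hind]
    exact IsSemialgebraicFunOn.measurable_indicator_of_tarskiSeidenberg hTS hh hΔm
  -- the sign sets of `h` off `Z`
  set σp : Set (Fin 2 → ℝ) := {p | p ∈ Δ ∧ 0 < h p} ∩ (U \ Z) with hσp_def
  set σn : Set (Fin 2 → ℝ) := {p | p ∈ Δ ∧ h p < 0} ∩ (U \ Z) with hσn_def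
  have hσpsa : IsSemialgebraic ℚ σp := by
    refine Literature.ModelTheory.ExponentialFields.IsSemialgebraic.inter ?_ hVsa
    convert IsSemialgebraicFunOn.isSemialgebraic_sep_lt hTS hh.neg 0 0 using 1
    ext p; simp
  have hσnsa : IsSemialgebraic ℚ σn := by
    refine Literature.ModelTheory.ExponentialFields.IsSemialgebraic.inter ?_ hVsa
    convert IsSemialgebraicFunOn.isSemialgebraic_sep_lt hTS hh 0 0 using 1
    ext p; simp
  -- continuity and bound of `A` along the closed vertical fibres
  have hmemΔ : ∀ a ∈ Ioo (0 : ℝ) 1, ∀ s ∈ Icc (0 : ℝ) (1 - a), (![a, s] : Fin 2 → ℝ) ∈ Δ := by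
    intro a ha s hs
    simp only [hΔ_def, mem_setOf_eq, Matrix.cons_val_zero, Matrix.cons_val_one]
    exact ⟨ha.1.le, hs.1, by linarith [hs.2]⟩
  have hcontF : ∀ a ∈ Ioo (0 : ℝ) 1, ContinuousOn (fun s : ℝ => A ![a, s]) (Icc 0 (1 - a)) := by
    intro a ha
    have hc : Continuous fun s : ℝ => (![a, s] : Fin 2 → ℝ) := by fun_prop
    exact hAc.comp hc.continuousOn fun s hs => hmemΔ a ha s hs
  have hMF : ∀ a ∈ Ioo (0 : ℝ) 1, ∀ s ∈ Icc (0 : ℝ) (1 - a), |A ![a, s]| ≤ M := by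
    intro a ha s hs
    have := hM _ (hmemΔ a ha s hs)
    rwa [Real.norm_eq_abs] at this
  -- finiteness over the two sign sets (`A`, resp. `-A`, increasing along the fibres)
  have hfinp : ∫⁻ p, σp.indicator (fun p => ‖h p‖ₑ) p < ∞ :=
    lintegral_indicator_enorm_lt_top (F := A) hσpsa (fun p hp => hp.2.1) hcontF hMF
      (fun p hp => hderV p hp.2) (fun p hp => hp.1.2.le) hmeas
  have hfinn : ∫⁻ p, σn.indicator (fun p => ‖h p‖ₑ) p < ∞ := by
    have := lintegral_indicator_enorm_lt_top (F := fun p => -A p) (f := fun p => -h p) hσnsa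
      (fun p hp => hp.2.1) (fun a ha => (hcontF a ha).neg)
      (fun a ha s hs => by rw [abs_neg]; exact hMF a ha s hs) (fun p hp => (hderV p hp.2).neg)
      (fun p hp => neg_nonneg.2 hp.1.2.le) hmeas.neg
    simpa only [enorm_neg] using this
  -- `|h| ≤ 1_{σp} |h| + 1_{σn} |h|` off the null set `Z`
  have hle : ∀ᵐ p ∂volume, ‖h p‖ₑ ≤
      σp.indicator (fun p => ‖h p‖ₑ) p + σn.indicator (fun p => ‖h p‖ₑ) p := by
    filter_upwards [measure_eq_zero_iff_ae_notMem.1 hZnull] with p hpZ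
    by_cases hpU : p ∈ U
    · rcases lt_trichotomy (h p) 0 with hlt | heq | hgt
      · rw [indicator_of_mem (show p ∈ σn from ⟨⟨hUΔ hpU, hlt⟩, hpU, hpZ⟩)]
        exact le_add_self
      · rw [heq, enorm_zero]
        exact bot_le
      · rw [indicator_of_mem (show p ∈ σp from ⟨⟨hUΔ hpU, hgt⟩, hpU, hpZ⟩)]
        exact le_self_add
    · rw [hhU p hpU, enorm_zero]
      exact bot_le
  -- `h` is integrable on the plane, a fortiori on `Δ`
  have hint : Integrable h volume := by
    refine ⟨hmeas.aestronglyMeasurable, ?_⟩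
    show ∫⁻ p, ‖h p‖ₑ ∂volume < ∞
    refine lt_of_le_of_lt (lintegral_mono_ae hle) ?_
    rw [lintegral_add_left (hmeas.enorm.indicator
      (Literature.ModelTheory.ExponentialFields.IsSemialgebraic.measurableSet_holds hσpsa))]
    exact ENNReal.add_lt_top.2 ⟨hfinp, hfinn⟩
  exact hint.integrableOn

end Summit.KontsevichZagierPeriods.SymplecticScissors.PlanarAreas

end
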